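import Literature.MathematicalPhysics.QuantumFieldTheory.Balaban1983to89.B9Eq343CovariantResolventHolderLetters
import Literature.MathematicalPhysics.QuantumFieldTheory.Balaban1983to89.B9Eq342TowerBigBlocks

/-!
# `Balaban1983to89.B9Eq347CoshRowOfLocalTower` — T. Bałaban, *Propagators for lattice gauge theories in a background field*, Commun. Math. Phys. **99** (1985) 389–434
# [Balaban1985BackgroundPropagators] (3.47) p. 398 (the summation of the local estimates over the blocks, «Σ_{y′} e^{−δ₀d(y,y′)} ≤ K»), (3.49) p. 399, Thm 3.1 (3.42) p. 397:
# **FROM A LOCAL (block-supported source, block-decayed output) ROW AT THE TOWER TO A ROW IN THE `cosh`-WEIGHTED CURRENCY of this lineage's perturbative files** — for ANY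
# linear map `T` on the site functions of `T_{(L^{n+1}m)}` with `‖(Tg)(x)‖ ≤ B_X·e^{−κ d_m(Π(σx), v′)}·sup|g|` for `g` supported over the big block `v′`, and data
# `‖f(y)‖ ≤ N·W_{x₀}(y)` (product-`cosh` weight of rate `a` centred at any fine site `x₀`): `‖(Tf)(x)‖ ≤ B_X·e^{ad(L^{n+1}−1)}·K_d(κ − adL^{n+1})·N·W_{x₀}(σx)` whenever
# `adL^{n+1} < κ` — the socket through which the OWNER's CLOSED local rows of `G′_k` (value `exists_decayRow_GpOfUk`, gradient `exists_gradRow_GpOfUk`) inhabit the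
# `Hgrad`-type letters of `B9Eq343CovariantResolventHolderAdjointRow` at the tower

statement-level skeleton of published theorems with citation tags; proofs where landed; nothing here is a claim about the Yang–Mills mass gap

CITATION HEADER (lean-in-tree rule).  Audit cell `pub-balaban`, sub-cell `t4`, BINDER row NE9; filed by NE9 crux-team LEAF PROVER 01 (`b2b-balaban-t4-ne9-formalise-leaf-01`,
gen 93; bears_on: R4/N22).  Source READ first-hand (`paper:balaban1985-cmp99-background-propagators`): p. 398 (3.47), p. 399 (3.49), p. 397 Thm 3.1.  Inputs BY NAME:
`B9Eq343CovariantResolventHolderLetters.weight_le_exp_mul_of_tdist_le` (the weight over a sup-ball), `B9Eq342TowerBigBlocks.tdist_le_mul_tdist_bigBlock_add`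
(`d_{(L^{n+1}m)} ≤ L^{n+1}·d_m(Π·,Π·) + (L^{n+1} − 1)`), `B4Sect5Torus.torusSum_le` (`Σ_v e^{−r d_m(u,v)} ≤ K_d(r)`).  [folklore] composition; nothing printed is asserted.

WHAT IS PROVED (sorry-free; proof lane — 0 `def`).
* **`cosh_row_of_local`** — the statement above (block decomposition `f = Σ_{v′} 1_{Π⁻¹v′}f`, the weight of a block against the weight at `σx`, the torus sum).
HONEST SCOPE.  Bookkeeping; the rate condition `adL^{n+1} < κ` is the consumer's choice of the `cosh` rate `a` (any `a` in the window of the perturbative files; the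
decay then read is `aL^{n+1}`).  NOT summit progress (cell pub-balaban: NE9 NOT PRINTED ∕ NOT PROVED; «NE9 ⇐ the named binders»; row WALLED ON A MODEL (O-NE9-1; #5
UNRULED); spine PROVED 0∕9; rung (B)+1 finite T⁴ — NOT infinite volume, NOT mass gap, NOT BetaPertH, NOT Clay).  HONEST DEPENDENCY (cell line): continuum YM on T⁴ ⇐ BetaPertH
∧ nine spine estimates (0/9 proved); BetaPertH ⇐ (D1) ∧ (D4) ∧ CAP+tail; G-an2-4 gates asym, D1 and NE2/3/4.  NEW file; nothing modified.  Net new unproved facts: 0.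
-/

noncomputable section

open scoped BigOperators

namespace Literature.MathematicalPhysics.QuantumFieldTheory.Balaban1983to89.B9Eq347CoshRowOfLocalTower

open B4Sect5Torus (TSite tdist tdist_nonneg tdist_symm torusSum_le)
open B4Sect5Proof (latticeConst latticeConst_nonneg)
open B4TorusKernel.MultiPeriod (circAbs)
open B9Eq319QprimeTorus (fineP blockCoord)
open B9Eq315QTower (towerP)
open B9Eq316TowerFlatIsOneStep (towerP_eq_fineP_pow siteCast)
open B9Eq342TowerBigBlocks (tdist_le_mul_tdist_bigBlock_add)
open B9Eq342CoshWeightSite (weight_site_pos)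
open B9Eq343CovariantResolventHolderLetters (weight_le_exp_mul_of_tdist_le)

variable {d : ℕ} (L : ℕ) [NeZero L] (m : Fin d → ℕ) [∀ i, NeZero (m i)] (n : ℕ)
  {W : Type*} [NormedAddCommGroup W] [InnerProductSpace ℂ W]

/-- **FROM A LOCAL ROW TO A `cosh`-WEIGHTED ROW AT THE TOWER ((3.47) summation).**  Let `T` be a linear map on the site functions of `T_{(L^{n+1}m)}` into functions on an
index set `X′` with attached sites `σ : X′ → T_{(L^{n+1}m)}`, obeying the LOCAL row `‖(Tg)(x)‖ ≤ B_X·e^{−κ d_m(Π(σx), v′)}·F` for every `g` supported over the big block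
`v′` with `‖g‖ ≤ F`.  If `0 ≤ a`, `a·d·L^{n+1} < κ` and `‖f(y)‖ ≤ N·W_{x₀}(y)` (product-`cosh` weight of rate `a` centred at `x₀`), then
`‖(Tf)(x)‖ ≤ B_X·e^{a·d·(L^{n+1} − 1)}·K_d(κ − a·d·L^{n+1})·N·W_{x₀}(σx)`. [folklore]
[cite: Balaban1985BackgroundPropagators, (3.47) p.398, (3.49) p.399, Thm 3.1 (3.42) p.397] -/
theorem cosh_row_of_local {X' : Type*} {V : Type*} [NormedAddCommGroup V] [NormedSpace ℂ V]
    (T : (TSite d (towerP L m (n + 1)) → W) →ₗ[ℂ] (X' → V)) (σ : X' → TSite d (towerP L m (n + 1))) {BX κ a : ℝ} (hBX : 0 ≤ BX) (ha : 0 ≤ a)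
    (hκa : a * d * (L : ℝ) ^ (n + 1) < κ)
    (hloc : ∀ (v' : TSite d m) (g : TSite d (towerP L m (n + 1)) → W) (F : ℝ),
      (∀ y, blockCoord (L ^ (n + 1)) m (siteCast (towerP_eq_fineP_pow L m (n + 1)) y) ≠ v' → g y = 0) → (∀ y, ‖g y‖ ≤ F) →
      ∀ x, ‖T g x‖ ≤ BX * Real.exp (-(κ * tdist m (blockCoord (L ^ (n + 1)) m (siteCast (towerP_eq_fineP_pow L m (n + 1)) (σ x))) v')) * F)
    (x₀ : TSite d (towerP L m (n + 1))) (f : TSite d (towerP L m (n + 1)) → W) {N : ℝ} (hN : 0 ≤ N)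
    (hf : ∀ y, ‖f y‖ ≤ N * ∏ μ, Real.cosh (a * (circAbs (towerP L m (n + 1) μ)
      ((((x₀ μ : ℕ) : ZMod (towerP L m (n + 1) μ)) - ((y μ : ℕ) : ZMod (towerP L m (n + 1) μ))).val) : ℝ)))
    (x : X') :
    ‖T f x‖ ≤ BX * Real.exp (a * d * ((L : ℝ) ^ (n + 1) - 1)) * latticeConst d (κ - a * d * (L : ℝ) ^ (n + 1)) * N *
      ∏ μ, Real.cosh (a * (circAbs (towerP L m (n + 1) μ)
        ((((x₀ μ : ℕ) : ZMod (towerP L m (n + 1) μ)) - ((σ x μ : ℕ) : ZMod (towerP L m (n + 1) μ))).val) : ℝ)) := by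
  classical
  have hm : ∀ i, 1 ≤ m i := fun i => Nat.one_le_iff_ne_zero.mpr (NeZero.ne (m i))
  set K : ℝ := (L : ℝ) ^ (n + 1) with hK
  set Pb : TSite d (towerP L m (n + 1)) → TSite d m := fun y => blockCoord (L ^ (n + 1)) m (siteCast (towerP_eq_fineP_pow L m (n + 1)) y) with hPb
  set Wx : ℝ := ∏ μ, Real.cosh (a * (circAbs (towerP L m (n + 1) μ)
        ((((x₀ μ : ℕ) : ZMod (towerP L m (n + 1) μ)) - ((σ x μ : ℕ) : ZMod (towerP L m (n + 1) μ))).val) : ℝ)) with hWx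
  have hWx0 : 0 < Wx := weight_site_pos (towerP L m (n + 1)) a x₀ (σ x)
  -- the block pieces
  set fp : TSite d m → TSite d (towerP L m (n + 1)) → W := fun v' y => if Pb y = v' then f y else 0 with hfp
  have hsum : f = ∑ v' : TSite d m, fp v' := by
    funext y
    rw [Finset.sum_apply]
    simp only [hfp]
    rw [Finset.sum_ite_eq]; simp
  have hTsum : T f x = ∑ v' : TSite d m, T (fp v') x := by rw [hsum, map_sum, Finset.sum_apply]
  -- each piece: block-supported, sup bounded by the weight of its block against `W(σx)`
  have hpiece : ∀ v' : TSite d m, ‖T (fp v') x‖ ≤ BX * N * Real.exp (a * d * (K - 1)) * Wx * Real.exp (-((κ - a * d * K) * tdist m (Pb (σ x)) v')) := by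
    intro v'
    set D : ℝ := tdist m (Pb (σ x)) v' with hD
    have hD0 : 0 ≤ D := tdist_nonneg _ _ _
    have hF : ∀ y, ‖fp v' y‖ ≤ N * Real.exp (a * d * (K * D + (K - 1))) * Wx := by
      intro y
      simp only [hfp]
      by_cases hy : Pb y = v'
      · rw [if_pos hy]
        have hdist : tdist (towerP L m (n + 1)) y (σ x) ≤ K * D + (K - 1) := by
          have h1 := tdist_le_mul_tdist_bigBlock_add L m (n + 1) hm y (σ x)
          rw [hD, tdist_symm hm]
          have e : blockCoord (L ^ (n + 1)) m (siteCast (towerP_eq_fineP_pow L m (n + 1)) y) = v' := hy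
          rw [e] at h1
          exact h1
        have hW := weight_le_exp_mul_of_tdist_le ha x₀ (σ x) y hdist
        exact (hf y).trans ((mul_le_mul_of_nonneg_left hW hN).trans (le_of_eq (by rw [hWx]; ring)))
      · rw [if_neg hy, norm_zero]; positivity
    have h := hloc v' (fp v') _ (fun y hy => by simp only [hfp]; rw [if_neg hy]) hF x
    refine h.trans (le_of_eq ?_)
    rw [show a * d * (K * D + (K - 1)) = a * d * (K - 1) + a * d * K * D by ring, Real.exp_add,
      show -((κ - a * d * K) * D) = -(κ * D) + a * d * K * D by ring, Real.exp_add]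
    ring
  rw [hTsum]
  calc ‖∑ v' : TSite d m, T (fp v') x‖ ≤ ∑ v' : TSite d m, ‖T (fp v') x‖ := norm_sum_le _ _
    _ ≤ ∑ v' : TSite d m, BX * N * Real.exp (a * d * (K - 1)) * Wx * Real.exp (-((κ - a * d * K) * tdist m (Pb (σ x)) v')) := Finset.sum_le_sum fun v' _ => hpiece v'
    _ = BX * N * Real.exp (a * d * (K - 1)) * Wx * ∑ v' : TSite d m, Real.exp (-((κ - a * d * K) * tdist m (Pb (σ x)) v')) := by rw [Finset.mul_sum]
    _ ≤ BX * N * Real.exp (a * d * (K - 1)) * Wx * latticeConst d (κ - a * d * K) :=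
        mul_le_mul_of_nonneg_left (torusSum_le d hm (sub_pos.2 hκa) _) (by positivity)
    _ = _ := by ring

end Literature.MathematicalPhysics.QuantumFieldTheory.Balaban1983to89.B9Eq347CoshRowOfLocalTower

end
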